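import Mathlib
import Summits.ValiantsHypothesis.ValiantsHypothesis.Theorems.NewtonUnitEquationsTwoProductsFormalLogLinearisationDefs
import Literature.Computability.AlgebraicComplexity.NewtonPolygonTau
import Literature.Computability.AlgebraicComplexity.NewtonPolygonTauProductBounds
import HarnessLib

/-!
# Route NewtonUnitEquations — crux `TwoProducts` (stmt-ValiantsHypothesis-5906), line `formal-log-linearisation`:
# sector tools for stub 1 (`stub_sectorDecomposition`): top-assignments, their count, and their fibres

Registered line `Cruxes/TwoProducts/Lines/formal-log-linearisation.lean` (NOT the item's skeleton of record;
helper mode, no stub credit claimed). Objects `Expo` / `wt` / `IsStrictTop` / `Cancelling` / `hidden` = the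
line's vocabulary, verbatim, in the companion `Theorems/NewtonUnitEquationsTwoProductsFormalLogLinearisationDefs.lean`
(one Defs file for the whole line). This file is the TOOLBOX of the sector decomposition (stub 1 itself is
assembled in `Theorems/NewtonUnitEquationsTwoProductsFormalLogLinearisationSectorDecomposition.lean`), over the
tree's planar Minkowski-sum API `KPTT.PlanarMinkowski` of `Literature/…/NewtonPolygonTauProductBounds.lean`:

* `isStrictTop_iff_planar` — the line's `IsStrictTop ξ ↑S l` (exponent sets, weight `wt`) is the tree's planar
  `IsStrictTop ξ (image S) (image l)` on the real embedding of exponents;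
* `isStrictTop_mul`, `isStrictTop_prod` — OSTROWSKI: if `a j` is the strict `w`-top of `supp f_j` for all `j`,
  then `Σ a_j` is the strict `w`-top of `supp ∏ f_j` with coefficient `∏ coeff (a j) (f j)` (no cancellation of
  extreme monomials over the domain `ℂ`);
* `tuple_eq_of_sum_eq`, `card_topTuples_le_ncard_extremePoints`, `card_topTuples_le_sum_card` — the
  ASSIGNMENT COUNT: a finite set of tuples of strict tops (one common weight per tuple) of the sets `S i` injects
  by the sum map into the hull vertices of the Minkowski sum `Σ_i S i`, hence has at most `#vert conv(Σ S i) ≤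
  Σ_i #(S i)` elements (tree: `IsStrictTop.fintype_sum`, `mem_extremePoints`, `ncard_extremePoints_sum_le_sum_card`);
* `eq_or_eq_of_top_sub`, `eq_or_eq_of_not_cancelling` — the NON-CANCELLING FIBRE: in the sector of a
  non-cancelling top-assignment `(a, b)` a strict top of `supp (∏ f − ∏ g)` is one of the two product tops
  `Σ a_j`, `Σ b_j`;
* `mem_hidden_of_tops`, `hidden_finite'` — the CANCELLING FIBRE lies in the (finite) hidden set, by definition.

Honest framing: planar convex-geometry bookkeeping of the line; the line's engine `stub_logSumEngine` stays OPEN,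
the crux `TwoProducts` stays OPEN, the line is not the item's skeleton of record, and nothing here is progress on
`VP ≠ VNP` (NOT proved). No definitions, no named facts.
-/

noncomputable section

-- Sub = Summit single-conjunct layout: the duplicated namespace component is mandated by the tree.
set_option linter.dupNamespace false

namespace Summit.ValiantsHypothesis.ValiantsHypothesis.Theorems.NewtonUnitEquations.TwoProducts.FormalLogLinearisation

open MvPolynomial Literature.Computability.AlgebraicComplexity
open scoped BigOperators Pointwise


/-! ### The real embedding of exponent vectors -/

/-- The real embedding of exponent vectors is additive. [folklore] -/
theorem natEmb_add (e e' : Expo) :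
    (fun i : Fin 2 => (((e + e') i : ℕ) : ℝ)) =
      (fun i : Fin 2 => ((e i : ℕ) : ℝ)) + fun i : Fin 2 => ((e' i : ℕ) : ℝ) := by
  ext i; simp

/-- The real embedding of exponent vectors is injective. [folklore] -/
theorem natEmb_injective :
    Function.Injective fun e : Expo => fun i : Fin 2 => ((e i : ℕ) : ℝ) := by
  intro e e' h
  ext i
  have hi := congr_fun h i
  simp only [Nat.cast_inj] at hi
  exact hi

/-- The line's weight is the dot product with the embedded exponent. [folklore] -/
theorem wt_eq_dotProduct (ξ : Fin 2 → ℝ) (e : Expo) :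
    wt ξ e = ξ ⬝ᵥ fun i : Fin 2 => ((e i : ℕ) : ℝ) := by
  simp [wt, dotProduct, Fin.sum_univ_two]

/-- The line's `IsStrictTop` on a finite exponent set is the tree's planar `IsStrictTop` on its real image.
[folklore] -/
theorem isStrictTop_iff_planar (ξ : Fin 2 → ℝ) (S : Finset Expo) (l : Expo) :
    IsStrictTop ξ (↑S) l ↔
      KPTT.PlanarMinkowski.IsStrictTop ξ (S.image fun e : Expo => fun i : Fin 2 => ((e i : ℕ) : ℝ))
        (fun i : Fin 2 => ((l i : ℕ) : ℝ)) := by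
  classical
  constructor
  · rintro ⟨hl, hlt⟩
    refine ⟨Finset.mem_image_of_mem _ (Finset.mem_coe.1 hl), fun y hy hne => ?_⟩
    obtain ⟨μ, hμ, rfl⟩ := Finset.mem_image.1 hy
    have hμl : μ ≠ l := fun h => hne (by rw [h])
    have := hlt μ (Finset.mem_coe.2 hμ) hμl
    rwa [wt_eq_dotProduct, wt_eq_dotProduct] at this
  · rintro ⟨hl, hlt⟩
    obtain ⟨l', hl', hll'⟩ := Finset.mem_image.1 hl
    have : l' = l := natEmb_injective hll'
    subst this
    refine ⟨Finset.mem_coe.2 hl', fun μ hμ hne => ?_⟩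
    have hne' : (fun i : Fin 2 => ((μ i : ℕ) : ℝ)) ≠ fun i : Fin 2 => ((l' i : ℕ) : ℝ) :=
      fun h => hne (natEmb_injective h)
    have := hlt _ (Finset.mem_image_of_mem _ (Finset.mem_coe.1 hμ)) hne'
    rwa [wt_eq_dotProduct, wt_eq_dotProduct]

/-! ### Planar strict tops: restriction, membership, tops of products (Ostrowski) -/

/-- A strict top of a set that lies in a subset is a strict top of the subset. [folklore] -/
theorem planarIsStrictTop_mono {w : Fin 2 → ℝ} {F G : Finset (Fin 2 → ℝ)} {x : Fin 2 → ℝ}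
    (h : KPTT.PlanarMinkowski.IsStrictTop w F x) (hGF : G ⊆ F) (hx : x ∈ G) :
    KPTT.PlanarMinkowski.IsStrictTop w G x :=
  ⟨hx, fun y hy hne => h.2 y (hGF hy) hne⟩

/-- The exponent of a strict top of an embedded support is a monomial. [folklore] -/
theorem coeff_ne_zero_of_planarIsStrictTop {w : Fin 2 → ℝ} {p : MvPolynomial (Fin 2) ℂ} {α : Expo}
    (h : KPTT.PlanarMinkowski.IsStrictTop w (p.support.image fun e : Expo => fun i : Fin 2 => ((e i : ℕ) : ℝ))
      (fun i : Fin 2 => ((α i : ℕ) : ℝ))) : coeff α p ≠ 0 := by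
  obtain ⟨α', hα', h'⟩ := Finset.mem_image.1 h.1
  have : α' = α := natEmb_injective h'
  subst this
  exact MvPolynomial.mem_support_iff.1 hα'

/-- **Ostrowski for two factors.** If `α`, `β` are the strict `w`-tops of `supp p`, `supp q`, then the
coefficient of `X^(α+β)` in `p q` is `coeff α p · coeff β q` and `α + β` is the strict `w`-top of `supp (p q)`.
[folklore] -/
theorem isStrictTop_mul {w : Fin 2 → ℝ} {p q : MvPolynomial (Fin 2) ℂ} {α β : Expo}
    (hp : KPTT.PlanarMinkowski.IsStrictTop w (p.support.image fun e : Expo => fun i : Fin 2 => ((e i : ℕ) : ℝ))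
      (fun i : Fin 2 => ((α i : ℕ) : ℝ)))
    (hq : KPTT.PlanarMinkowski.IsStrictTop w (q.support.image fun e : Expo => fun i : Fin 2 => ((e i : ℕ) : ℝ))
      (fun i : Fin 2 => ((β i : ℕ) : ℝ))) :
    coeff (α + β) (p * q) = coeff α p * coeff β q ∧
      KPTT.PlanarMinkowski.IsStrictTop w ((p * q).support.image fun e : Expo => fun i : Fin 2 => ((e i : ℕ) : ℝ))
        (fun i : Fin 2 => (((α + β) i : ℕ) : ℝ)) := by
  classical
  set emb : Expo → (Fin 2 → ℝ) := fun e i => ((e i : ℕ) : ℝ) with hemb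
  -- the coefficient: all other splittings of `α + β` vanish
  have hcoeff : coeff (α + β) (p * q) = coeff α p * coeff β q := by
    rw [MvPolynomial.coeff_mul, Finset.sum_eq_single (α, β)]
    · rintro ⟨α', β'⟩ hmem hne
      rw [Finset.HasAntidiagonal.mem_antidiagonal] at hmem
      by_contra hprod
      have hα' : coeff α' p ≠ 0 := fun h0 => hprod (by rw [h0, zero_mul])
      have hβ' : coeff β' q ≠ 0 := fun h0 => hprod (by rw [h0, mul_zero])
      have hα'm : emb α' ∈ p.support.image emb :=
        Finset.mem_image_of_mem _ (MvPolynomial.mem_support_iff.2 hα')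
      have hβ'm : emb β' ∈ q.support.image emb :=
        Finset.mem_image_of_mem _ (MvPolynomial.mem_support_iff.2 hβ')
      have h1 : w ⬝ᵥ emb α' ≤ w ⬝ᵥ emb α := hp.le hα'm
      have h2 : w ⬝ᵥ emb β' ≤ w ⬝ᵥ emb β := hq.le hβ'm
      have hsum : w ⬝ᵥ emb α' + w ⬝ᵥ emb β' = w ⬝ᵥ emb α + w ⬝ᵥ emb β := by
        rw [← dotProduct_add, ← dotProduct_add]
        have e1 : emb α' + emb β' = emb (α' + β') := (natEmb_add α' β').symm
        have e2 : emb α + emb β = emb (α + β) := (natEmb_add α β).symm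
        rw [e1, e2, hmem]
      rcases ne_or_eq α' α with hαne | hαeq
      · have hne' : emb α' ≠ emb α := fun h => hαne (natEmb_injective h)
        have h1' : w ⬝ᵥ emb α' < w ⬝ᵥ emb α := hp.lt hα'm hne'
        linarith
      · subst hαeq
        have hβne : β' ≠ β := fun h => hne (by rw [h])
        have hne' : emb β' ≠ emb β := fun h => hβne (natEmb_injective h)
        have h2' : w ⬝ᵥ emb β' < w ⬝ᵥ emb β := hq.lt hβ'm hne'
        linarith
    · intro h
      exact absurd (by simp) h
  refine ⟨hcoeff, ?_⟩
  -- the strict top: restrict the top of `supp p + supp q` to `supp (p q)`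
  have hne : coeff (α + β) (p * q) ≠ 0 := by
    rw [hcoeff]
    exact mul_ne_zero (coeff_ne_zero_of_planarIsStrictTop hp) (coeff_ne_zero_of_planarIsStrictTop hq)
  have hadd := hp.add hq
  have e2 : emb α + emb β = emb (α + β) := (natEmb_add α β).symm
  rw [e2] at hadd
  refine planarIsStrictTop_mono hadd ?_ (Finset.mem_image_of_mem _ (MvPolynomial.mem_support_iff.2 hne))
  intro y hy
  obtain ⟨γ, hγ, rfl⟩ := Finset.mem_image.1 hy
  obtain ⟨γ₁, hγ₁, γ₂, hγ₂, rfl⟩ := Finset.mem_add.1 (MvPolynomial.support_mul p q hγ)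
  rw [show emb (γ₁ + γ₂) = emb γ₁ + emb γ₂ from natEmb_add γ₁ γ₂]
  exact Finset.add_mem_add (Finset.mem_image_of_mem _ hγ₁) (Finset.mem_image_of_mem _ hγ₂)

/-- **Ostrowski for a finite product.** If `a j` is the strict `w`-top of `supp (f j)` for every `j ∈ s`, then
the coefficient of `X^(Σ a_j)` in `∏ f_j` is `∏ coeff (a j) (f j)` and `Σ a_j` is the strict `w`-top of
`supp (∏ f_j)`. [folklore] -/
theorem isStrictTop_prod {ι : Type*} (s : Finset ι) (f : ι → MvPolynomial (Fin 2) ℂ) (a : ι → Expo)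
    {w : Fin 2 → ℝ}
    (h : ∀ j ∈ s, KPTT.PlanarMinkowski.IsStrictTop w
      ((f j).support.image fun e : Expo => fun i : Fin 2 => ((e i : ℕ) : ℝ)) (fun i : Fin 2 => ((a j i : ℕ) : ℝ))) :
    coeff (∑ j ∈ s, a j) (∏ j ∈ s, f j) = ∏ j ∈ s, coeff (a j) (f j) ∧
      KPTT.PlanarMinkowski.IsStrictTop w
        ((∏ j ∈ s, f j).support.image fun e : Expo => fun i : Fin 2 => ((e i : ℕ) : ℝ))
        (fun i : Fin 2 => (((∑ j ∈ s, a j) i : ℕ) : ℝ)) := by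
  classical
  induction s using Finset.cons_induction with
  | empty =>
    simp only [Finset.sum_empty, Finset.prod_empty, MvPolynomial.coeff_one, if_true, true_and]
    refine ⟨Finset.mem_image_of_mem _ (by simp), fun y hy hne => ?_⟩
    obtain ⟨γ, hγ, rfl⟩ := Finset.mem_image.1 hy
    have hγ0 : γ = 0 := by
      have := MvPolynomial.mem_support_iff.1 hγ
      rw [MvPolynomial.coeff_one] at this
      by_contra h0
      exact this (if_neg (Ne.symm h0))
    subst hγ0
    exact absurd rfl hne
  | cons b s hb ih =>
    rw [Finset.sum_cons, Finset.prod_cons, Finset.prod_cons]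
    have ih' := ih fun j hj => h j (Finset.mem_cons.2 (Or.inr hj))
    have hb' := h b (Finset.mem_cons_self _ _)
    have key := isStrictTop_mul hb' ih'.2
    exact ⟨by rw [key.1, ih'.1], key.2⟩

/-! ### Counting realised top-assignments: distinct assignments have distinct vertex sums -/

/-- If `τ i` is the strict `w`-top of `S i` for every `i` and `τ' i ∈ S i` has the same total `Σ τ' = Σ τ`,
then `τ' = τ` (each `⟨w, τ' i⟩ ≤ ⟨w, τ i⟩` and the totals agree). [folklore] -/
theorem tuple_eq_of_sum_eq {ι : Type*} [Fintype ι] {S : ι → Finset (Fin 2 → ℝ)} {w : Fin 2 → ℝ}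
    {τ τ' : ι → (Fin 2 → ℝ)} (hτ : ∀ i, KPTT.PlanarMinkowski.IsStrictTop w (S i) (τ i))
    (hτ' : ∀ i, τ' i ∈ S i) (hsum : ∑ i, τ' i = ∑ i, τ i) : τ' = τ := by
  have hle : ∀ i, w ⬝ᵥ τ' i ≤ w ⬝ᵥ τ i := fun i => (hτ i).le (hτ' i)
  have htot : ∑ i, (w ⬝ᵥ τ i - w ⬝ᵥ τ' i) = 0 := by
    rw [Finset.sum_sub_distrib, ← dotProduct_sum, ← dotProduct_sum, hsum, sub_self]
  have hzero := (Finset.sum_eq_zero_iff_of_nonneg fun i _ => sub_nonneg.2 (hle i)).1 htot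
  funext i
  by_contra hne
  have hlt := (hτ i).lt (hτ' i) hne
  have := hzero i (Finset.mem_univ i)
  linarith

/-- **Assignment count.** A finite set of tuples, each of which is a tuple of strict tops of the sets `S i` for
some common weight, has at most `#vert conv(Σ_i S i)` elements: the sum map is injective on it
(`tuple_eq_of_sum_eq`) and lands in the hull vertices of the Minkowski sum (tops add up). [folklore] -/
theorem card_topTuples_le_ncard_extremePoints {ι : Type*} [Fintype ι] (S : ι → Finset (Fin 2 → ℝ))
    (T : Finset (ι → (Fin 2 → ℝ)))
    (hT : ∀ τ ∈ T, ∃ w : Fin 2 → ℝ, ∀ i, KPTT.PlanarMinkowski.IsStrictTop w (S i) (τ i)) :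
    T.card ≤ ((convexHull ℝ ((∑ i, S i : Finset (Fin 2 → ℝ)) : Set (Fin 2 → ℝ))).extremePoints ℝ).ncard := by
  classical
  have hinj : Set.InjOn (fun τ : ι → (Fin 2 → ℝ) => ∑ i, τ i) ↑T := by
    intro τ hτ τ' hτ' heq
    obtain ⟨w, hw⟩ := hT τ (Finset.mem_coe.1 hτ)
    obtain ⟨w', hw'⟩ := hT τ' (Finset.mem_coe.1 hτ')
    exact (tuple_eq_of_sum_eq hw (fun i => (hw' i).1) heq.symm).symm
  rw [← Finset.card_image_of_injOn hinj, ← Set.ncard_coe_finset]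
  refine Set.ncard_le_ncard ?_ ((∑ i, S i : Finset (Fin 2 → ℝ)).finite_toSet.subset
    extremePoints_convexHull_subset)
  intro s hs
  obtain ⟨τ, hτ, rfl⟩ := Finset.mem_image.1 (Finset.mem_coe.1 hs)
  obtain ⟨w, hw⟩ := hT τ hτ
  exact (KPTT.PlanarMinkowski.IsStrictTop.fintype_sum hw).mem_extremePoints

/-- Point-count form of the assignment count for a nonempty index type: `#T ≤ Σ_i #(S i)`.
[folklore] -/
theorem card_topTuples_le_sum_card {ι : Type*} [Fintype ι] [Nonempty ι] (S : ι → Finset (Fin 2 → ℝ))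
    (hS : ∀ i, (S i).Nonempty) (T : Finset (ι → (Fin 2 → ℝ)))
    (hT : ∀ τ ∈ T, ∃ w : Fin 2 → ℝ, ∀ i, KPTT.PlanarMinkowski.IsStrictTop w (S i) (τ i)) :
    T.card ≤ ∑ i, (S i).card :=
  (card_topTuples_le_ncard_extremePoints S T hT).trans
    (KPTT.PlanarMinkowski.ncard_extremePoints_sum_le_sum_card Finset.univ Finset.univ_nonempty S
      fun i _ => hS i)

/-! ### The fibre of an assignment: non-cancelling sectors expose only the two product tops -/

/-- In the sector of a top-assignment whose product tops are `A` (for `P`, coefficient `coeff A P`) and `B`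
(for `Q`), a strict top `l` of `supp (P − Q)` that is a monomial of `P` is `A` or `B` — unless the assignment is
cancelling (`A = B` with equal coefficients). [folklore] -/
theorem eq_or_eq_of_top_sub {w : Fin 2 → ℝ} {P Q : MvPolynomial (Fin 2) ℂ} {A B l : Expo}
    (hA : KPTT.PlanarMinkowski.IsStrictTop w (P.support.image fun e : Expo => fun i : Fin 2 => ((e i : ℕ) : ℝ))
      (fun i : Fin 2 => ((A i : ℕ) : ℝ)))
    (hB : KPTT.PlanarMinkowski.IsStrictTop w (Q.support.image fun e : Expo => fun i : Fin 2 => ((e i : ℕ) : ℝ))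
      (fun i : Fin 2 => ((B i : ℕ) : ℝ)))
    (hl : KPTT.PlanarMinkowski.IsStrictTop w
      ((P - Q).support.image fun e : Expo => fun i : Fin 2 => ((e i : ℕ) : ℝ)) (fun i : Fin 2 => ((l i : ℕ) : ℝ)))
    (hlP : coeff l P ≠ 0) :
    l = A ∨ l = B ∨ (A = B ∧ coeff A P = coeff B Q) := by
  classical
  set emb : Expo → (Fin 2 → ℝ) := fun e i => ((e i : ℕ) : ℝ) with hemb
  by_contra hcon
  push Not at hcon
  obtain ⟨hlA, hlB, hAB⟩ := hcon
  have hαne : coeff A P ≠ 0 := coeff_ne_zero_of_planarIsStrictTop hA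
  have hβne : coeff B Q ≠ 0 := coeff_ne_zero_of_planarIsStrictTop hB
  -- `l` is a monomial of `P` below its top `A`
  have h1 : w ⬝ᵥ emb l < w ⬝ᵥ emb A :=
    hA.lt (Finset.mem_image_of_mem _ (MvPolynomial.mem_support_iff.2 hlP)) fun h => hlA (natEmb_injective h)
  -- hence `A` is not a monomial of `P - Q`: it cancels against `Q`
  have hAh : coeff A (P - Q) = 0 := by
    by_contra hne
    have := hl.le (Finset.mem_image_of_mem _ (MvPolynomial.mem_support_iff.2 hne))
    linarith
  have hAQ : coeff A Q = coeff A P := by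
    rw [MvPolynomial.coeff_sub] at hAh
    linear_combination -hAh
  have hAQne : coeff A Q ≠ 0 := by rw [hAQ]; exact hαne
  have hAneB : A ≠ B := fun h => hAB h (by rw [← hAQ, h])
  have h2 : w ⬝ᵥ emb A < w ⬝ᵥ emb B :=
    hB.lt (Finset.mem_image_of_mem _ (MvPolynomial.mem_support_iff.2 hAQne)) fun h => hAneB (natEmb_injective h)
  -- `B` is not a monomial of `P` (it lies above `A`), so it survives in `P - Q`
  have hBP : coeff B P = 0 := by
    by_contra hne
    have := hA.le (Finset.mem_image_of_mem _ (MvPolynomial.mem_support_iff.2 hne))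
    linarith
  have hBh : coeff B (P - Q) ≠ 0 := by
    rw [MvPolynomial.coeff_sub, hBP, zero_sub, neg_ne_zero]
    exact hβne
  have h3 : w ⬝ᵥ emb B ≤ w ⬝ᵥ emb l :=
    hl.le (Finset.mem_image_of_mem _ (MvPolynomial.mem_support_iff.2 hBh))
  linarith

/-- **Non-cancelling fibre.** If `(a, b)` is a NON-cancelling top-assignment realised by `w` and `l` is the
strict `w`-top of `supp (∏ f − ∏ g)`, then `l` is one of the two product tops `Σ a_j`, `Σ b_j`. [folklore] -/
theorem eq_or_eq_of_not_cancelling {m : ℕ} {f g : Fin m → MvPolynomial (Fin 2) ℂ} {a b : Fin m → Expo}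
    {w : Fin 2 → ℝ} {l : Expo}
    (ha : ∀ j, KPTT.PlanarMinkowski.IsStrictTop w
      ((f j).support.image fun e : Expo => fun i : Fin 2 => ((e i : ℕ) : ℝ)) (fun i : Fin 2 => ((a j i : ℕ) : ℝ)))
    (hb : ∀ j, KPTT.PlanarMinkowski.IsStrictTop w
      ((g j).support.image fun e : Expo => fun i : Fin 2 => ((e i : ℕ) : ℝ)) (fun i : Fin 2 => ((b j i : ℕ) : ℝ)))
    (hl : KPTT.PlanarMinkowski.IsStrictTop w
      ((∏ j, f j - ∏ j, g j).support.image fun e : Expo => fun i : Fin 2 => ((e i : ℕ) : ℝ))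
      (fun i : Fin 2 => ((l i : ℕ) : ℝ)))
    (hnc : ¬ Cancelling f g a b) : l = ∑ j, a j ∨ l = ∑ j, b j := by
  classical
  have hPa := isStrictTop_prod Finset.univ f a fun j _ => ha j
  have hQb := isStrictTop_prod Finset.univ g b fun j _ => hb j
  have hlh : coeff l (∏ j, f j - ∏ j, g j) ≠ 0 := coeff_ne_zero_of_planarIsStrictTop hl
  rw [MvPolynomial.coeff_sub] at hlh
  by_cases hlP : coeff l (∏ j, f j) ≠ 0
  · rcases eq_or_eq_of_top_sub hPa.2 hQb.2 hl hlP with h | h | ⟨h1, h2⟩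
    · exact Or.inl h
    · exact Or.inr h
    · exact absurd ⟨h1, by rw [← hPa.1, ← hQb.1, h2]⟩ hnc
  · push Not at hlP
    have hlQ : coeff l (∏ j, g j) ≠ 0 := by
      intro h0; exact hlh (by rw [hlP, h0, sub_zero])
    -- symmetric case: `supp (Q - P) = supp (P - Q)`
    have hl' : KPTT.PlanarMinkowski.IsStrictTop w
        ((∏ j, g j - ∏ j, f j).support.image fun e : Expo => fun i : Fin 2 => ((e i : ℕ) : ℝ))
        (fun i : Fin 2 => ((l i : ℕ) : ℝ)) := by
      have e : (∏ j, g j - ∏ j, f j).support = (∏ j, f j - ∏ j, g j).support := by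
        rw [← MvPolynomial.support_neg, neg_sub]
      rw [e]; exact hl
    rcases eq_or_eq_of_top_sub hQb.2 hPa.2 hl' hlQ with h | h | ⟨h1, h2⟩
    · exact Or.inr h
    · exact Or.inl h
    · exact absurd ⟨h1.symm, by rw [← hPa.1, ← hQb.1, h2]⟩ hnc

/-- **Cancelling fibre.** If `(a, b)` is realised by `w` and `l` is the strict `w`-top of `supp (∏ f − ∏ g)`,
then `l` is a hidden vertex of `(a, b)` (definition of `hidden`). [folklore] -/
theorem mem_hidden_of_tops {m : ℕ} {f g : Fin m → MvPolynomial (Fin 2) ℂ} {a b : Fin m → Expo}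
    {w : Fin 2 → ℝ} {l : Expo}
    (ha : ∀ j, KPTT.PlanarMinkowski.IsStrictTop w
      ((f j).support.image fun e : Expo => fun i : Fin 2 => ((e i : ℕ) : ℝ)) (fun i : Fin 2 => ((a j i : ℕ) : ℝ)))
    (hb : ∀ j, KPTT.PlanarMinkowski.IsStrictTop w
      ((g j).support.image fun e : Expo => fun i : Fin 2 => ((e i : ℕ) : ℝ)) (fun i : Fin 2 => ((b j i : ℕ) : ℝ)))
    (hl : KPTT.PlanarMinkowski.IsStrictTop w
      ((∏ j, f j - ∏ j, g j).support.image fun e : Expo => fun i : Fin 2 => ((e i : ℕ) : ℝ))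
      (fun i : Fin 2 => ((l i : ℕ) : ℝ))) :
    l ∈ hidden f g a b :=
  ⟨w, fun j => (isStrictTop_iff_planar w _ _).2 (ha j), fun j => (isStrictTop_iff_planar w _ _).2 (hb j),
    (isStrictTop_iff_planar w _ _).2 hl⟩

/-- The hidden set of a top-assignment is finite (it lies in the support of `∏ f − ∏ g`). [folklore] -/
theorem hidden_finite' {m : ℕ} (f g : Fin m → MvPolynomial (Fin 2) ℂ) (a b : Fin m → Expo) :
    (hidden f g a b).Finite :=
  (∏ j, f j - ∏ j, g j).support.finite_toSet.subset fun _ ⟨_, _, _, hl⟩ => hl.1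


end Summit.ValiantsHypothesis.ValiantsHypothesis.Theorems.NewtonUnitEquations.TwoProducts.FormalLogLinearisation

end
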